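import Mathlib
import HarnessLib
import Summits.HubbardSuperconductivity.HubbardSuperconductivity.Theorems.KLProgrammeKLRegimeTwoPointLimitCooperResummation

/-!
# Route `KLProgramme`, crux K3 (stmt-HubbardSuperconductivity-19937) — the SINGLE-SLICE pair-ladder resummation with COMPLEX bubble
# weights: existence of the one-step inverse `N` of `PairLadderStepAtV5`, the ladder-graph series it sums, push-through, entry bounds,
# and the cost of replacing the true slice bubble by a nonnegative model (cell gate-hubbard-kl, seat hubbard-kl-k3c1-p1, g0)

Engine-facing sequel to p1's `…CooperResummation` family (composed-map / resolvent algebra).  The engine child `KLRegimeEngineV7`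
(stmt-HubbardSuperconductivity-19662) must SUPPLY, at every scale `n ≥ 1` and every pair-class total momentum, the clause (E2-v5)
`PairLadderStepAtV5`: weights `w ≥ 0` with `Σ w ≤ bhi`, a matrix `N` with `(1 + diag w · 𝒞_{n−1})·N = 1`, and a bound on
`𝒞_n − 𝒞_{n−1}·N`.  Within ONE slice the ladder is a CONVERGENT Neumann series — the slice mass `Σ|w| ≤ bhi = O(1)` times the array size
`m = O(|U|)` is small — so no sign and no Sherman–Morrison step is needed (those enter only the COMPOSED resummation over `c/U²` slices, child 1's
business, closed in `…KLRegimeBetaSplitV7`), and the weights may be COMPLEX: the true one-slice particle–particle bubble at total momentum `Q ≠ 0`,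
`z_p = β⁻¹ Σ_ω ĝ_n(ω,p) ĝ_n(−ω, Q − p)`, is what the engine's graph expansion literally produces.  For a finite carrier `S`, `C : Matrix S S ℂ` with
`|C(s,t)| ≤ m` and complex weights `z` with `m·Σ_s |z_s| ≤ 1/3`, writing `D = diag z`:

* `klcrs_single_slice`: there are `N`, `N₀` with `(1 + D·C)·N = 1 = N·(1 + D·C)`, `(1 + C·D)·N₀ = 1 = N₀·(1 + C·D)`, the push-through `C·N = N₀·C`,
  `‖N₀‖ ≤ 3/2`, `‖N₀ − 1‖ ≤ (3/2)·m·Σ|z|` (max-row-sum norm), the entry bounds `|(C·N)(s,t)| ≤ (3/2)·m` and `|(C·N − C)(s,t)| ≤ (3/2)·m²·Σ|z|`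
  (one slice moves the array by `O(m²·Σ|z|)`), and THE LADDER SERIES: `HasSum (j ↦ (−D·C)^j) N` — so the engine's «sum over pair-ladder graphs with
  `j` slice-`n` bubbles» `Σ_j C·(−D·C)^j` IS `C·N` (`klcrs_single_slice_ladder_hasSum`);
* `klcrs_finite_ladder`: the topology-free form — for every `J`, `C·N = Σ_{j<J} C·(−D·C)^j + (−C·D)^J·N₀·C` with the remainder entrywise
  `≤ (m·Σ|z|)^J·(3/2)·m`;
* `klcrs_weight_perturbation`: for two weight vectors `z₁, z₂` (both small) and the corresponding one-step inverses,
  `|(C·N₁ − C·N₂)(s,t)| ≤ (9/4)·m²·Σ_s|z₁ s − z₂ s|` — the price of replacing the true complex slice bubble `z₁` by the nonnegative model `z₂ = w` that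
  (E2-v5) quantifies over (`Σ|z₁ − w|` is the bubble's non-scalar / curvature / `Q`-dependence slack of the slice, an `O(4^{−θn})`-small mass, so the
  cost is `O(U²·4^{−θn})` = the `cloc`-part of `eremBar`).

Pure finite-dimensional linear algebra in Mathlib's `L^∞`-operator (max-row-sum) matrix norm; nothing about the model is asserted.  The instantiation
(`S = TorusSite 2 L`, `C = klPairArray … (n−1) Q` — zero off the ball, so `|C| ≤ m := u + (C_W + klLegKappa·CR·Klam³)U²` everywhere from the history's
`PairArrayAtV2 (n−1)` — and `z =` the slice bubble) is the engine prover's.  References: HOME/p1/CHILD1-SKELETON.md §5 (compose / one-shot propagation),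
HOME/p1/ENGINE-PRED.md §2 (E2)/§3 (ii) (bubble slack), BGM 2006 §3 (3.65)–(3.67).
-/

noncomputable section

namespace Summit.HubbardSuperconductivity.HubbardSuperconductivity.Theorems.KLProgrammeCooperResummation

set_option linter.dupNamespace false -- summit = problem name (single-conjunct summit), D-0017

open scoped Matrix.Norms.Operator
open Matrix Finset

variable {S : Type*} [Fintype S] [DecidableEq S]

/-! ### Row sums with complex weights -/

/-- Row sums of `C·diag z` for complex weights: `‖C·diag z‖ ≤ m·Σ_s ‖z_s‖` when `|C(s,t)| ≤ m`. -/
theorem klcrs_norm_mul_diagonal_le (z : S → ℂ) {m : ℝ} (hm : 0 ≤ m) (C : Matrix S S ℂ) (hC : ∀ s t, ‖C s t‖ ≤ m) :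
    ‖C * Matrix.diagonal z‖ ≤ m * ∑ s, ‖z s‖ := by
  refine klcr_norm_le_of_rows _ (mul_nonneg hm (sum_nonneg fun s _ => norm_nonneg _)) fun i => ?_
  calc ∑ j, ‖(C * Matrix.diagonal z) i j‖ = ∑ j, ‖C i j‖ * ‖z j‖ := by
        refine sum_congr rfl fun j _ => ?_
        rw [Matrix.mul_diagonal, norm_mul]
    _ ≤ ∑ j, m * ‖z j‖ := sum_le_sum fun j _ => mul_le_mul_of_nonneg_right (hC i j) (norm_nonneg _)
    _ = m * ∑ s, ‖z s‖ := by rw [Finset.mul_sum]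

/-- Entries of a product: `|(A·C)(s,t)| ≤ ‖A‖·m` for all `s t` when `|C| ≤ m` everywhere. -/
theorem klcrs_mul_entry_le (A C : Matrix S S ℂ) {m : ℝ} (hm : 0 ≤ m) (hC : ∀ s t, ‖C s t‖ ≤ m) (s t : S) :
    ‖(A * C) s t‖ ≤ ‖A‖ * m :=
  klcr_mul_entry_le A C hm t (fun k => hC k t) s

/-- The sign bookkeeping of the ladder series: `D·(−(C·D))^j·C = −(−(D·C))^(j+1)`. -/
theorem klcrs_ladder_term (C D : Matrix S S ℂ) (j : ℕ) : D * (-(C * D)) ^ j * C = -(-(D * C)) ^ (j + 1) := by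
  induction j with
  | zero => simp
  | succ j ih =>
      calc D * (-(C * D)) ^ (j + 1) * C = (D * (-(C * D)) ^ j * C) * (-(D * C)) := by rw [pow_succ]; noncomm_ring
        _ = -(-(D * C)) ^ (j + 1) * (-(D * C)) := by rw [ih]
        _ = -(-(D * C)) ^ (j + 1 + 1) := by rw [pow_succ (-(D * C)) (j + 1)]; noncomm_ring

/-- The finite ladder expansion of the resummed one-step inverse: from `(1 + X)·N₀ = 1`, for every `J`,
`N₀ = Σ_{j<J} (−X)^j + (−X)^J·N₀`. -/
theorem klcrs_neumann_partial (X N₀ : Matrix S S ℂ) (h : (1 + X) * N₀ = 1) (J : ℕ) :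
    N₀ = ∑ j ∈ range J, (-X) ^ j + (-X) ^ J * N₀ := by
  have hstep : N₀ = 1 + (-X) * N₀ := by
    have h' : N₀ + X * N₀ = 1 := by rw [add_mul, one_mul] at h; exact h
    calc N₀ = 1 - X * N₀ := by rw [← h']; abel
      _ = 1 + (-X) * N₀ := by rw [neg_mul, sub_eq_add_neg]
  induction J with
  | zero => simp
  | succ J ih =>
      rw [sum_range_succ, pow_succ]
      calc N₀ = ∑ j ∈ range J, (-X) ^ j + (-X) ^ J * N₀ := ih
        _ = ∑ j ∈ range J, (-X) ^ j + (-X) ^ J * (1 + (-X) * N₀) := by rw [← hstep]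
        _ = ∑ j ∈ range J, (-X) ^ j + (-X) ^ J + (-X) ^ J * (-X) * N₀ := by noncomm_ring

variable [Nonempty S]

/-! ### The single-slice resummation -/

/-- **Single-slice pair-ladder resummation with complex bubble weights.**  For `|C(s,t)| ≤ m` and complex weights `z` with `m·Σ|z| ≤ 1/3`,
with `D = diag z`: there are `N`, `N₀` with `(1 + D·C)·N = 1 = N·(1 + D·C)`, `(1 + C·D)·N₀ = 1 = N₀·(1 + C·D)`, `C·N = N₀·C` (push-through),
`‖N₀‖ ≤ 3/2`, `‖N₀ − 1‖ ≤ (3/2)·m·Σ|z|`, `|(C·N)(s,t)| ≤ (3/2)·m`, `|(C·N − C)(s,t)| ≤ (3/2)·m²·Σ|z|`, and the ladder series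
`HasSum (j ↦ (−D·C)^j) N`. -/
theorem klcrs_single_slice (z : S → ℂ) {m : ℝ} (hm : 0 ≤ m) (C : Matrix S S ℂ) (hC : ∀ s t, ‖C s t‖ ≤ m)
    (hθ : m * ∑ s, ‖z s‖ ≤ 1 / 3) :
    ∃ N N₀ : Matrix S S ℂ,
      (1 + Matrix.diagonal z * C) * N = 1 ∧ N * (1 + Matrix.diagonal z * C) = 1 ∧
      (1 + C * Matrix.diagonal z) * N₀ = 1 ∧ N₀ * (1 + C * Matrix.diagonal z) = 1 ∧
      C * N = N₀ * C ∧ ‖N₀‖ ≤ 3 / 2 ∧ ‖N₀ - 1‖ ≤ 3 / 2 * (m * ∑ s, ‖z s‖) ∧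
      (∀ s t, ‖(C * N) s t‖ ≤ 3 / 2 * m) ∧ (∀ s t, ‖(C * N - C) s t‖ ≤ 3 / 2 * m * (m * ∑ s, ‖z s‖)) ∧
      HasSum (fun j : ℕ => (-(Matrix.diagonal z * C)) ^ j) N := by
  set D : Matrix S S ℂ := Matrix.diagonal z with hD_def
  set X : Matrix S S ℂ := C * D with hX_def
  have hXn' : ‖X‖ ≤ m * ∑ s, ‖z s‖ := klcrs_norm_mul_diagonal_le z hm C hC
  have hXn : ‖X‖ ≤ 1 / 3 := hXn'.trans hθ
  -- the Neumann inverse of `1 + X`, with its series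
  have hX' : ‖-X‖ < 1 := by rw [norm_neg]; linarith
  haveI : CompleteSpace (Matrix S S ℂ) := inferInstance
  let u := Units.oneSub (-X) hX'
  set N₀ : Matrix S S ℂ := ((u⁻¹ : (Matrix S S ℂ)ˣ) : Matrix S S ℂ) with hN₀_def
  have hval : (u : Matrix S S ℂ) = 1 + X := by simp [u]
  have hN₀1 : (1 + X) * N₀ = 1 := by rw [← hval, hN₀_def]; exact u.mul_inv
  have hN₀2 : N₀ * (1 + X) = 1 := by rw [← hval, hN₀_def]; exact u.inv_mul
  have hN₀tsum : N₀ = ∑' j : ℕ, (-X) ^ j := rfl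
  have hN₀sum : HasSum (fun j : ℕ => (-X) ^ j) N₀ := by
    rw [hN₀tsum]; exact (summable_geometric_of_norm_lt_one hX').hasSum
  have hN₀n : ‖N₀‖ ≤ 3 / 2 := by
    have h := tsum_geometric_le_of_norm_lt_one (-X) hX'
    rw [hN₀tsum]
    refine h.trans ?_
    rw [norm_one, norm_neg]
    have h3 : (1 - ‖X‖)⁻¹ ≤ 3 / 2 := by
      rw [inv_le_comm₀ (by linarith) (by norm_num)]; linarith
    linarith
  have hid : N₀ - 1 = -(X * N₀) := by
    have h1' : N₀ + X * N₀ = 1 := by rw [add_mul, one_mul] at hN₀1; exact hN₀1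
    calc N₀ - 1 = N₀ - (N₀ + X * N₀) := by rw [h1']
      _ = -(X * N₀) := by abel
  have hN₀m1 : ‖N₀ - 1‖ ≤ 3 / 2 * (m * ∑ s, ‖z s‖) := by
    rw [hid, norm_neg]
    calc ‖X * N₀‖ ≤ ‖X‖ * ‖N₀‖ := norm_mul_le _ _
      _ ≤ (m * ∑ s, ‖z s‖) * (3 / 2) := mul_le_mul hXn' hN₀n (norm_nonneg _) (by positivity)
      _ = 3 / 2 * (m * ∑ s, ‖z s‖) := by ring
  -- the one-step inverse on the other side: `N = 1 − D·N₀·C`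
  set N : Matrix S S ℂ := 1 - D * N₀ * C with hN_def
  have hXN₀ : X * N₀ = 1 - N₀ := by
    have h1' : N₀ + X * N₀ = 1 := by rw [add_mul, one_mul] at hN₀1; exact hN₀1
    rw [← h1']; abel
  have hN₀X : N₀ * X = 1 - N₀ := by
    have h2' : N₀ + N₀ * X = 1 := by rw [mul_add, mul_one] at hN₀2; exact hN₀2
    rw [← h2']; abel
  have hN1 : (1 + D * C) * N = 1 := by
    calc (1 + D * C) * N = 1 + D * (1 - N₀ - (C * D) * N₀) * C := by rw [hN_def]; noncomm_ring
      _ = 1 := by rw [← hX_def, hXN₀]; noncomm_ring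
  have hN2 : N * (1 + D * C) = 1 := by
    calc N * (1 + D * C) = 1 + D * (1 - N₀ - N₀ * (C * D)) * C := by rw [hN_def]; noncomm_ring
      _ = 1 := by rw [← hX_def, hN₀X]; noncomm_ring
  have hpush : C * N = N₀ * C := by
    calc C * N = (1 - (C * D) * N₀) * C := by rw [hN_def]; noncomm_ring
      _ = N₀ * C := by rw [← hX_def, hXN₀]; noncomm_ring
  -- entry bounds
  have hCN : ∀ s t, ‖(C * N) s t‖ ≤ 3 / 2 * m := by
    intro s t
    rw [hpush]
    calc ‖(N₀ * C) s t‖ ≤ ‖N₀‖ * m := klcrs_mul_entry_le N₀ C hm hC s t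
      _ ≤ 3 / 2 * m := mul_le_mul_of_nonneg_right hN₀n hm
  have hCNC : ∀ s t, ‖(C * N - C) s t‖ ≤ 3 / 2 * m * (m * ∑ s, ‖z s‖) := by
    intro s t
    have h1 : C * N - C = (N₀ - 1) * C := by rw [hpush]; noncomm_ring
    rw [h1]
    calc ‖((N₀ - 1) * C) s t‖ ≤ ‖N₀ - 1‖ * m := klcrs_mul_entry_le (N₀ - 1) C hm hC s t
      _ ≤ 3 / 2 * (m * ∑ s, ‖z s‖) * m := mul_le_mul_of_nonneg_right hN₀m1 hm
      _ = 3 / 2 * m * (m * ∑ s, ‖z s‖) := by ring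
  -- the ladder series: `N = Σ_j (−D·C)^j`
  have hser : HasSum (fun j : ℕ => (-(D * C)) ^ j) N := by
    have h1 : HasSum (fun j : ℕ => D * (-X) ^ j * C) (D * N₀ * C) := (hN₀sum.mul_left D).mul_right C
    have h2 : HasSum (fun j : ℕ => (-(D * C)) ^ (j + 1)) (-(D * N₀ * C)) := by
      have h1' := h1.neg
      refine h1'.congr_fun ?_
      intro j
      rw [hX_def, klcrs_ladder_term C D j, neg_neg]
    have h3 := (hasSum_nat_add_iff' (f := fun j : ℕ => (-(D * C)) ^ j) 1 (g := N)).1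
    refine h3 ?_
    have : N - ∑ i ∈ range 1, (-(D * C)) ^ i = -(D * N₀ * C) := by
      rw [sum_range_one, pow_zero, hN_def]; abel
    rw [this]
    exact h2
  exact ⟨N, N₀, hN1, hN2, hN₀1, hN₀2, hpush, hN₀n, hN₀m1, hCN, hCNC, hser⟩

/-- **The ladder series, stated on its own**: under the hypotheses of `klcrs_single_slice`, ANY right inverse `N` of `1 + diag z·C` is the sum
of the ladder series `Σ_j (−diag z·C)^j`, and `C·N = Σ_j C·(−diag z·C)^j` (the sum over pair-ladder graphs with `j` slice bubbles). -/
theorem klcrs_single_slice_ladder_hasSum (z : S → ℂ) {m : ℝ} (hm : 0 ≤ m) (C : Matrix S S ℂ) (hC : ∀ s t, ‖C s t‖ ≤ m)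
    (hθ : m * ∑ s, ‖z s‖ ≤ 1 / 3) (N : Matrix S S ℂ) (hN : (1 + Matrix.diagonal z * C) * N = 1) :
    HasSum (fun j : ℕ => (-(Matrix.diagonal z * C)) ^ j) N ∧ HasSum (fun j : ℕ => C * (-(Matrix.diagonal z * C)) ^ j) (C * N) := by
  obtain ⟨N', N₀, h1, h2, -, -, -, -, -, -, -, hser⟩ := klcrs_single_slice z hm C hC hθ
  -- right inverses are unique: `N = N'`
  have hNN' : N = N' := by
    calc N = (N' * (1 + Matrix.diagonal z * C)) * N := by rw [h2, one_mul]
      _ = N' * ((1 + Matrix.diagonal z * C) * N) := by rw [mul_assoc]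
      _ = N' := by rw [hN, mul_one]
  subst hNN'
  exact ⟨hser, hser.mul_left C⟩

/-- **Finite ladder expansion with remainder (topology-free form).**  With the matrices `klcrs_single_slice` provides (only `(1 + C·diag z)·N₀ = 1`,
the push-through and `‖N₀‖ ≤ 3/2` are used; no smallness is needed for the identity): for every `J`, `C·N = Σ_{j<J} C·(−diag z·C)^j + (−C·diag z)^J·N₀·C`, and the remainder is entrywise `≤ (m·Σ|z|)^J·(3/2)·m`. -/
theorem klcrs_finite_ladder (z : S → ℂ) {m : ℝ} (hm : 0 ≤ m) (C : Matrix S S ℂ) (hC : ∀ s t, ‖C s t‖ ≤ m)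
    (N N₀ : Matrix S S ℂ) (hN₀ : (1 + C * Matrix.diagonal z) * N₀ = 1) (hpush : C * N = N₀ * C)
    (hN₀n : ‖N₀‖ ≤ 3 / 2) (J : ℕ) :
    C * N = ∑ j ∈ range J, C * (-(Matrix.diagonal z * C)) ^ j + (-(C * Matrix.diagonal z)) ^ J * N₀ * C ∧
    ∀ s t, ‖((-(C * Matrix.diagonal z)) ^ J * N₀ * C) s t‖ ≤ (m * ∑ s, ‖z s‖) ^ J * (3 / 2 * m) := by
  set D : Matrix S S ℂ := Matrix.diagonal z with hD_def
  set X : Matrix S S ℂ := C * D with hX_def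
  have hXn' : ‖X‖ ≤ m * ∑ s, ‖z s‖ := klcrs_norm_mul_diagonal_le z hm C hC
  -- `(−X)^j · C = C · (−D C)^j`
  have hcomm : ∀ j : ℕ, (-X) ^ j * C = C * (-(D * C)) ^ j := by
    intro j
    induction j with
    | zero => simp
    | succ j ih =>
        calc (-X) ^ (j + 1) * C = (-X) ^ j * ((-X) * C) := by rw [pow_succ, mul_assoc]
          _ = (-X) ^ j * (C * (-(D * C))) := by rw [hX_def]; congr 1; noncomm_ring
          _ = ((-X) ^ j * C) * (-(D * C)) := by noncomm_ring
          _ = C * (-(D * C)) ^ (j + 1) := by rw [ih, pow_succ, mul_assoc]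
  constructor
  · have h := klcrs_neumann_partial X N₀ hN₀ J
    calc C * N = N₀ * C := hpush
      _ = (∑ j ∈ range J, (-X) ^ j + (-X) ^ J * N₀) * C := by rw [← h]
      _ = ∑ j ∈ range J, (-X) ^ j * C + (-X) ^ J * N₀ * C := by rw [add_mul, sum_mul]
      _ = ∑ j ∈ range J, C * (-(D * C)) ^ j + (-X) ^ J * N₀ * C := by
          congr 1; exact sum_congr rfl fun j _ => hcomm j
  · intro s t
    have hpow : ‖(-X) ^ J * N₀‖ ≤ (m * ∑ s, ‖z s‖) ^ J * (3 / 2) := by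
      calc ‖(-X) ^ J * N₀‖ ≤ ‖(-X) ^ J‖ * ‖N₀‖ := norm_mul_le _ _
        _ ≤ ‖-X‖ ^ J * ‖N₀‖ := mul_le_mul_of_nonneg_right (norm_pow_le _ _) (norm_nonneg _)
        _ ≤ (m * ∑ s, ‖z s‖) ^ J * (3 / 2) := by
            rw [norm_neg]
            exact mul_le_mul (pow_le_pow_left₀ (norm_nonneg _) hXn' J) hN₀n (norm_nonneg _) (by positivity)
    calc ‖((-X) ^ J * N₀ * C) s t‖ ≤ ‖(-X) ^ J * N₀‖ * m := klcrs_mul_entry_le _ C hm hC s t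
      _ ≤ (m * ∑ s, ‖z s‖) ^ J * (3 / 2) * m := mul_le_mul_of_nonneg_right hpow hm
      _ = (m * ∑ s, ‖z s‖) ^ J * (3 / 2 * m) := by ring

omit [Nonempty S] in
/-- **Weight perturbation (replacing the true slice bubble by its nonnegative model).**  For `|C| ≤ m` and two weight vectors `z₁, z₂`, if
`A₁·(1 + C·diag z₁) = 1` and `(1 + C·diag z₂)·A₂ = 1` with `‖A₁‖, ‖A₂‖ ≤ 3/2` (the `N₀`'s of `klcrs_single_slice`), then
`|(A₁·C − A₂·C)(s,t)| ≤ (9/4)·m²·Σ_s |z₁ s − z₂ s|`; by push-through `A_i·C = C·N_i`, this bounds `C·N₁ − C·N₂` entrywise. -/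
theorem klcrs_weight_perturbation (z₁ z₂ : S → ℂ) {m : ℝ} (hm : 0 ≤ m) (C : Matrix S S ℂ) (hC : ∀ s t, ‖C s t‖ ≤ m)
    (A₁ A₂ : Matrix S S ℂ) (hA₁ : A₁ * (1 + C * Matrix.diagonal z₁) = 1) (hA₂ : (1 + C * Matrix.diagonal z₂) * A₂ = 1)
    (hA₁n : ‖A₁‖ ≤ 3 / 2) (hA₂n : ‖A₂‖ ≤ 3 / 2) (s t : S) :
    ‖(A₁ * C - A₂ * C) s t‖ ≤ 9 / 4 * m ^ 2 * ∑ s, ‖z₁ s - z₂ s‖ := by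
  set D₁ : Matrix S S ℂ := Matrix.diagonal z₁ with hD₁_def
  set D₂ : Matrix S S ℂ := Matrix.diagonal z₂ with hD₂_def
  -- resolvent identity: `A₁ − A₂ = A₁·C·(D₂ − D₁)·A₂`
  have hres : A₁ - A₂ = A₁ * C * (D₂ - D₁) * A₂ := by
    calc A₁ - A₂ = A₁ * ((1 + C * D₂) * A₂) - (A₁ * (1 + C * D₁)) * A₂ := by rw [hA₂, hA₁, mul_one, one_mul]
      _ = A₁ * C * (D₂ - D₁) * A₂ := by noncomm_ring
  have hdiff : A₁ * C - A₂ * C = (A₁ * C) * (D₂ - D₁) * (A₂ * C) := by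
    calc A₁ * C - A₂ * C = (A₁ - A₂) * C := by noncomm_ring
      _ = (A₁ * C) * (D₂ - D₁) * (A₂ * C) := by rw [hres]; noncomm_ring
  have hD : D₂ - D₁ = Matrix.diagonal (fun k => z₂ k - z₁ k) := by
    rw [hD₁_def, hD₂_def, Matrix.diagonal_sub]
  rw [hdiff, hD]
  have hB₁ : ∀ s k, ‖(A₁ * C) s k‖ ≤ 3 / 2 * m := fun s k =>
    (klcrs_mul_entry_le A₁ C hm hC s k).trans (mul_le_mul_of_nonneg_right hA₁n hm)
  have hB₂ : ∀ k t, ‖(A₂ * C) k t‖ ≤ 3 / 2 * m := fun k t =>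
    (klcrs_mul_entry_le A₂ C hm hC k t).trans (mul_le_mul_of_nonneg_right hA₂n hm)
  have hentry : ((A₁ * C) * Matrix.diagonal (fun k => z₂ k - z₁ k) * (A₂ * C)) s t =
      ∑ k, (A₁ * C) s k * (z₂ k - z₁ k) * (A₂ * C) k t := by
    rw [Matrix.mul_apply]
    refine sum_congr rfl fun k _ => ?_
    rw [Matrix.mul_diagonal]
  rw [hentry]
  calc ‖∑ k, (A₁ * C) s k * (z₂ k - z₁ k) * (A₂ * C) k t‖ ≤ ∑ k, ‖(A₁ * C) s k * (z₂ k - z₁ k) * (A₂ * C) k t‖ := norm_sum_le _ _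
    _ ≤ ∑ k, (3 / 2 * m) * ‖z₁ k - z₂ k‖ * (3 / 2 * m) := sum_le_sum fun k _ => by
        rw [norm_mul, norm_mul, norm_sub_rev (z₂ k) (z₁ k)]
        exact mul_le_mul (mul_le_mul_of_nonneg_right (hB₁ s k) (norm_nonneg _)) (hB₂ k t) (norm_nonneg _) (by positivity)
    _ = 9 / 4 * m ^ 2 * ∑ s, ‖z₁ s - z₂ s‖ := by rw [Finset.mul_sum]; exact sum_congr rfl fun k _ => by ring

/-- **Real nonnegative weights (the literal shape of (E2-v5) `PairLadderStepAtV5`).**  For `w ≥ 0` with `m·Σ w ≤ 1/3` and `|C| ≤ m` there is `N`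
with `(1 + diag (w : ℂ)·C)·N = 1`, `|(C·N)(s,t)| ≤ (3/2)·m` and `|(C·N − C)(s,t)| ≤ (3/2)·m²·Σ w`. -/
theorem klcrs_single_slice_real (w : S → ℝ) (hw : ∀ s, 0 ≤ w s) {m : ℝ} (hm : 0 ≤ m) (C : Matrix S S ℂ)
    (hC : ∀ s t, ‖C s t‖ ≤ m) (hθ : m * ∑ s, w s ≤ 1 / 3) :
    ∃ N : Matrix S S ℂ, (1 + Matrix.diagonal (fun s => (w s : ℂ)) * C) * N = 1 ∧ N * (1 + Matrix.diagonal (fun s => (w s : ℂ)) * C) = 1 ∧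
      (∀ s t, ‖(C * N) s t‖ ≤ 3 / 2 * m) ∧ (∀ s t, ‖(C * N - C) s t‖ ≤ 3 / 2 * m * (m * ∑ s, w s)) := by
  have hsum : ∑ s, ‖((w s : ℝ) : ℂ)‖ = ∑ s, w s :=
    sum_congr rfl fun s _ => by rw [Complex.norm_real, Real.norm_eq_abs, abs_of_nonneg (hw s)]
  have hθ' : m * ∑ s, ‖((w s : ℝ) : ℂ)‖ ≤ 1 / 3 := by rw [hsum]; exact hθ
  obtain ⟨N, N₀, h1, h2, -, -, -, -, -, hCN, hCNC, -⟩ := klcrs_single_slice (fun s => (w s : ℂ)) hm C hC hθ'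
  refine ⟨N, h1, h2, hCN, fun s t => ?_⟩
  have := hCNC s t
  rw [hsum] at this
  exact this

end Summit.HubbardSuperconductivity.HubbardSuperconductivity.Theorems.KLProgrammeCooperResummation

end
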